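import Summits.SmoothPoincare4.SmoothPoincare4.Theorems.SullivanDualWitnessChargeHelperEndHolomorphic
import Summits.SmoothPoincare4.SmoothPoincare4.Theorems.SullivanDualWitnessChargeHelperSlabBound

/-!
# Helpers `helper_memberSlab` and `helper_memberAvoidsFar` of line `Sketch` for crux `WitnessCharge`
(item stmt-SmoothPoincare4-7824; route `SullivanDual`, crux
`Summit.SmoothPoincare4.SmoothPoincare4.Theses.SullivanDual.WitnessCharge`; line `Sketch`,
registered stubs `helper_memberSlab` (W8a) and `helper_memberAvoidsFar` (W8b) of the lead's cycle-2
helper skeleton — confinement (P3)(b) for pencil members)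

**Slab bound for pencil members.** Let `J` be STANDARD on the punctured `ε'`-chart-ball `B_{ε'}` at
`p` (closed `ε'`-ball inside the chart target) and let `u : ℂ → Σ∖p` be a pencil member of intercept
`b` (`IsPencilMember J u b`: an entire `J`-curve, injective, immersed, proper, asymptotic to the flat
line `w = b`). In the complex flat coordinates `Ycoord p = (z, w)`:

* `helper_memberSlab`: `‖w(u ξ)‖ ≤ max ε'⁻¹ ‖b‖` whenever `u ξ ∈ B_{ε'}`;
* `helper_memberAvoidsFar`: `u` misses every point `x ∈ B_{ε'}` with `‖w(x)‖ > max ε'⁻¹ ‖b‖`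
  (in particular the far flat lines of larger intercept).

Proof: pure bookkeeping over two landed helpers. By `helper_endHolomorphic` (E0) the preimage
`U = u⁻¹(B_{ε'})` is open and `Ycoord ∘ u` is complex differentiable on `U`, hence so is its second
component (`DifferentiableOn.snd`); `u` is continuous (`ContMDiff.continuous`) and `w(u ξ) → b` along
`cocompact ℂ` is the last clause of `IsPencilMember`. These are exactly the hypotheses of
`helper_slabBound` (maximum modulus principle on superlevel sets), which gives the slab bound; the
avoidance statement is its contrapositive.
-/

noncomputable section

-- the registered namespace `Summit.SmoothPoincare4.SmoothPoincare4.…` repeats a component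
set_option linter.dupNamespace false

open scoped Manifold ContDiff Topology
open Set Filter Literature.Geometry.Kaehler Literature.Geometry.Symplectic
  Literature.Topology.FourManifolds

namespace Summit.SmoothPoincare4.SmoothPoincare4.Theorems.WitnessCharge.PencilIncompleteness

/-- **Slab bound for pencil members (W8a).** For `J` standard on the punctured `ε'`-chart-ball at
`p` (closed `ε'`-ball inside the chart target) and a pencil member `u` of intercept `b`, the
transverse flat coordinate satisfies `‖(Ycoord p (u ξ)).2‖ ≤ max ε'⁻¹ ‖b‖` at every `ξ` with
`u ξ` in the ball: `helper_endHolomorphic` makes `(Ycoord p ∘ u).2` complex differentiable on the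
open preimage of the ball, and `helper_slabBound` (maximum modulus) concludes. -/
theorem helper_memberSlab :
    ∀ (S : HomotopySphere 4) (p : S.carrier)
      (J : ∀ x : punctured p, TangentSpace (𝓡 4) x →L[ℝ] TangentSpace (𝓡 4) x) (ε' : ℝ)
      (u : ℂ → punctured p) (b : ℂ),
      0 < ε' →
      Metric.closedBall (extChartAt (𝓡 4) p p) ε' ⊆ (extChartAt (𝓡 4) p).target →
      (∀ x : punctured p, InPuncturedChartBall p ε' x →
        ∀ (v : TangentSpace (𝓡 4) x) (b : EuclideanSpace ℝ (Fin 4)),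
          inner ℝ (fderiv ℝ inversion (extChartAt (𝓡 4) p x.1 - extChartAt (𝓡 4) p p)
            (mfderiv (𝓡 4) 𝓘(ℝ, EuclideanSpace ℝ (Fin 4))
              (fun z : punctured p => extChartAt (𝓡 4) p z.1) x (J x v))) b
          = stdSymplecticForm (fderiv ℝ inversion (extChartAt (𝓡 4) p x.1 - extChartAt (𝓡 4) p p)
            (mfderiv (𝓡 4) 𝓘(ℝ, EuclideanSpace ℝ (Fin 4))
              (fun z : punctured p => extChartAt (𝓡 4) p z.1) x v)) b) →
      IsPencilMember J u b →
      ∀ ξ : ℂ, InPuncturedChartBall p ε' (u ξ) → ‖(Ycoord p (u ξ)).2‖ ≤ max ε'⁻¹ ‖b‖ := by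
  intro S p J ε' u b hε' hball hJstd hmem ξ hξ
  obtain ⟨hcurve, -, -, -, -, hlim⟩ := hmem
  obtain ⟨hUopen, hdiff, -, -⟩ :=
    helper_endHolomorphic S p J ε' hε' hball hJstd u hcurve.contMDiff hcurve.isJHolomorphic
  exact helper_slabBound S p ε' u b hε' hball hcurve.contMDiff.continuous hUopen hdiff.snd hlim
    ξ hξ

/-- **Members miss the far points (W8b).** For `J` standard on the punctured `ε'`-chart-ball at `p`
and a pencil member `u` of intercept `b`, no `ξ` is mapped to a point `x` of the ball whose
transverse flat coordinate has norm `> max ε'⁻¹ ‖b‖` (contrapositive of `helper_memberSlab`): the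
members avoid the far flat lines `w = b'`, `‖b'‖ > max ε'⁻¹ ‖b‖`. -/
theorem helper_memberAvoidsFar :
    ∀ (S : HomotopySphere 4) (p : S.carrier)
      (J : ∀ x : punctured p, TangentSpace (𝓡 4) x →L[ℝ] TangentSpace (𝓡 4) x) (ε' : ℝ)
      (u : ℂ → punctured p) (b : ℂ),
      0 < ε' →
      Metric.closedBall (extChartAt (𝓡 4) p p) ε' ⊆ (extChartAt (𝓡 4) p).target →
      (∀ x : punctured p, InPuncturedChartBall p ε' x →
        ∀ (v : TangentSpace (𝓡 4) x) (b : EuclideanSpace ℝ (Fin 4)),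
          inner ℝ (fderiv ℝ inversion (extChartAt (𝓡 4) p x.1 - extChartAt (𝓡 4) p p)
            (mfderiv (𝓡 4) 𝓘(ℝ, EuclideanSpace ℝ (Fin 4))
              (fun z : punctured p => extChartAt (𝓡 4) p z.1) x (J x v))) b
          = stdSymplecticForm (fderiv ℝ inversion (extChartAt (𝓡 4) p x.1 - extChartAt (𝓡 4) p p)
            (mfderiv (𝓡 4) 𝓘(ℝ, EuclideanSpace ℝ (Fin 4))
              (fun z : punctured p => extChartAt (𝓡 4) p z.1) x v)) b) →
      IsPencilMember J u b →
      ∀ x : punctured p, InPuncturedChartBall p ε' x → max ε'⁻¹ ‖b‖ < ‖(Ycoord p x).2‖ →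
        ∀ ξ : ℂ, u ξ ≠ x := by
  intro S p J ε' u b hε' hball hJstd hmem x hx hfar ξ hξx
  subst hξx
  exact lt_irrefl _ (hfar.trans_le (helper_memberSlab S p J ε' u b hε' hball hJstd hmem ξ hx))

end Summit.SmoothPoincare4.SmoothPoincare4.Theorems.WitnessCharge.PencilIncompleteness
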